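import Summits.BirchSwinnertonDyer.BirchSwinnertonDyer.Theses.SmallImageMuTransfer
import Summits.BirchSwinnertonDyer.BirchSwinnertonDyer.Theorems.SmallImageMuTransferAnalyticMuZeroX9RhoBarInvariance
import HarnessLib

/-!
# K6 crux `AnalyticMuZeroX9` (stmt-BirchSwinnertonDyer-19630): the CONGRUENCE-TRANSFER road at class
# level — the crux BY NAME from a unit-`L`-VALUE partner for every X9 pair (Greenberg–Vatsal /
# Emerton–Pollack–Weston transport), and its per-pair analytic corollaries

Cell `b2b-bsdres`, WIDTH-LEVER lane B on the crux (unit `b2b-bsdres-x9x`, gen 0; the first lane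
`b2b-bsdres-x9` works the direct θ-element / modular-symbol certificates). HONEST FRAMING: theorems
only (no definition, no new named fact, nothing asserted about any curve); `--supports` helper of item
19630; nothing is booked; BSD is not proved by any of this; the class-wide crux
`Rank1Residual.AnalyticMuZeroOnClassX9` is Greenberg's `μ = 0` (LNM 1716 Conj. 1.11, analytic side)
on class X9 and stays OPEN.

## What the congruence road gives, and exactly what it leaves open

The analytic `μ`-invariant is a `ρ̄`-invariant: Emerton–Pollack–Weston 2006 Thm. 1 (`∗ = an`; tree
named fact `EmertonPollackWeston2006.thm1_muAn_transfer_of_torsionIso`, cite-only) moves "some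
coefficient of `L_p(f, α)` is a `p`-adic unit" along any `Γ_ℚ`-equivariant `A[p] ≃ W[p]` between
curves good ordinary at `p ≥ 5` with irreducible `p`-torsion (kernel form:
`Rank1Residual.certificate_of_torsionIso`, koly g6). The cheapest SOURCE of such a certificate is a
unit `L`-VALUE: if the partner `A` is NON-ANOMALOUS at `p` (`p ∤ a_p(A) − 1`) and
`L(A,1)/Ω_A = q` with `ord_p q = 0`, then the CONSTANT coefficient of `L_p(f_A, α_A)` is a unit by
Mazur–Tate–Teitelbaum's interpolation `L_p(0) = (1 − α⁻¹)²·L(A,1)/Ω⁺_{f_A}` (tree theorem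
`constantCoeff_padicLFunction_unitRoot`), the period unit `Ω_A = u·Ω⁺_{f_A}`, `‖u‖_p = 1`
(`realPeriodRat_eq_unit_mul_plusPeriod`, Greenberg–Vatsal 2000 Rem. 3.4) and `1 − α⁻¹ = u'·#Ã(𝔽_p)`
(`exists_unit_one_sub_unitRoot_inv`). Hence:

* `analyticCertificate_of_unitLValue` — ANY globally minimal `A`, `p ≥ 5` good ordinary non-anomalous
  with `A[p]` irreducible, `L(A,1)/Ω_A` a `p`-adic unit: for EVERY newform `f` of `A` (any level) the
  constant coefficient of `L_p(f, α_A)` has norm `1` — the crux-shaped certificate WITHOUT `ϖ`, from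
  the period unit alone (no EPW, no modular-symbol engine). (The lane-A lemma
  `Rank1Residual.X9.unitCoeff_zero_of_lvalue`, `X9/HessePartnerTransport.lean`, is the Néron-shaped
  twin at level `N_A` with the kernel point count as hypothesis; here the hypothesis is `a_p`.)
* `analyticMuZeroOnClassX9_at_of_unitLValue` — the degenerate partner `A = W`: an X9 pair whose own
  `L`-value is a `p`-adic unit and which is non-anomalous satisfies the crux AT THE PAIR.
* `analyticMuZeroOnClassX9_at_of_unitLValuePartner` — an X9 pair `(W, p)` with a `p`-CONGRUENT
  partner `A` (good ordinary at `p`, `Γ_ℚ`-equivariant `A[p] ≃ W[p]`, non-anomalous, unit `L`-value)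
  satisfies the crux at the pair, for every newform of `W` — modulo EPW Thm. 1 (`hEPW`), the period
  unit (`h5`), Carayol (`hlev`) and modularity (`hmodP`, to have a newform of `A`).
* `analyticMuZeroX9_of_forall_exists_unitLValuePartner` — **the crux BY NAME**
  (`Theses.SmallImageMuTransfer.AnalyticMuZeroX9`) from the same three cite-only facts + modularity
  and ONE displayed class-wide hypothesis: «every X9 pair has a unit-`L`-value `p`-congruent partner»;
  `analyticMuZeroX9_of_muSplitInputs_of_forall_exists_unitLValuePartner` — the same with the facts
  packaged as the route's own items `MuSplitInputs` (19236) and `ModularParametrizationSupply` (19266).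

The displayed hypothesis is NOT a published fact and is NOT claimed: it is the EXACT open content of
the congruence road. It is an arithmetic ∀∃-statement over the infinitely many X9 residual
representations (`5Ns`, `5S4`, `7Ns` families); at `p = 5` every `ρ̄` has infinitely many elliptic
partners (the Hesse pencil `X_E(5) ≅ ℙ¹`, lane A gen 17), at `p = 7` only finitely many (`X_E(7)` has
genus `3`), and NO X9 Hida family contains a member whose `μ = 0` is a THEOREM in print (CM members:
the cyclotomic-line `μ` of Katz's two-variable measure is open — Gillard 1985 / Schneps 1987 settle
the one-prime tower only; Eisenstein members are excluded by irreducibility). So the road closes the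
crux pair by pair (census: 790/790 pairs at `N < 5·10⁵` certified by two engines, x9 g9) and
congruence class by congruence class, never class-wide; class-wide it is Greenberg's conjecture.

References: M. Emerton, R. Pollack, T. Weston, Invent. Math. 163 (2006) Thm. 1
[EmertonPollackWeston2006]; R. Greenberg, V. Vatsal, Invent. Math. 142 (2000) §3 Rem. (3.4), Thm.
(1.4) [GreenbergVatsal2000]; B. Mazur, J. Tate, J. Teitelbaum, Invent. Math. 84 (1986) §I.14 (14.3)
[MazurTateTeitelbaum1986Invent]; R. Greenberg, LNM 1716 (1999) Conj. 1.11 [GreenbergLNM1716].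
-/

-- the summit and its single problem are both named `BirchSwinnertonDyer` (registry layout D-0017)
set_option linter.dupNamespace false

set_option autoImplicit false

noncomputable section

open scoped Classical MatrixGroups ModularForm

open CongruenceSubgroup WeierstrassCurve Field
open Literature.NumberTheory.EllipticCurves Literature.NumberTheory.EllipticCurves.ModularForms
open Literature.NumberTheory.EllipticCurves.Rank1Residual (norm_periodRatio_eq_one
  hasIrreducibleModPGaloisRep_of_torsionIso_symm)

namespace Summit.BirchSwinnertonDyer.BirchSwinnertonDyer.Rank1Residual

/-! ### §1 The unit-`L`-value certificate (interpolation at the trivial character + period unit) -/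

/-- **Non-anomalous in `a_p`-currency ⟹ in point-count currency**: `a_p = p + 1 − #Ã(𝔽_p)`
(`WeierstrassCurve.frobeniusTrace`), so `p ∣ #Ã(𝔽_p)` would give `p ∣ a_p − 1`. [folklore] -/
theorem not_dvd_reductionPointCount_of_not_dvd_frobeniusTrace_sub_one
    (A : WeierstrassCurve ℚ) [A.IsGloballyMinimal] (p : ℕ)
    (hap : ¬ (p : ℤ) ∣ A.frobeniusTrace p - 1) : ¬ p ∣ A.reductionPointCount p := by
  intro h
  apply hap
  have h' : (p : ℤ) ∣ (A.reductionPointCount p : ℤ) := Int.natCast_dvd_natCast.mpr h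
  have hre : A.frobeniusTrace p - 1 = (p : ℤ) - (A.reductionPointCount p : ℤ) := by
    unfold WeierstrassCurve.frobeniusTrace
    ring
  rw [hre]
  exact dvd_sub dvd_rfl h'

/-- **The unit-`L`-value certificate, crux shape.** Let `A/ℚ` be globally minimal, `p ≥ 5` a prime
of good ordinary reduction with `A[p]` irreducible and `p ∤ a_p(A) − 1` (non-anomalous), and let
`L(A,1)/Ω_A = q ∈ ℚ` with `q ≠ 0`, `ord_p q = 0`. Then for EVERY newform `f` of `A` (any level) the
constant coefficient of `L_p(f, α_A)` is a `p`-adic unit: `L_p(f, α)(0) = (1 − α⁻¹)²·[0]⁺_f`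
(Mazur–Tate–Teitelbaum (14.3), tree theorem `constantCoeff_padicLFunction_unitRoot`),
`[0]⁺_f·Ω⁺_f = L(A,1)` (`IsNewformOf.entireLFunction_one_eq`), `Ω_A = u·Ω⁺_f` with `‖u‖_p = 1`
(`h5`, Greenberg–Vatsal Rem. 3.4) so `[0]⁺_f = u·q` is a unit, and `1 − α⁻¹ = u'·#Ã(𝔽_p)` is a unit
(`exists_unit_one_sub_unitRoot_inv`, non-anomalous). No modular-symbol engine and no transfer fact
is used. [cite: MazurTateTeitelbaum1986Invent, §I.14 (14.3)] [cite: GreenbergVatsal2000, §3 Remark (3.4)] -/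
theorem analyticCertificate_of_unitLValue (h5 : realPeriodRat_eq_unit_mul_plusPeriod)
    (A : WeierstrassCurve ℚ) [A.IsElliptic] [A.IsGloballyMinimal] (p : ℕ) [Fact p.Prime]
    (hp : 5 ≤ p) (hgood : A.HasGoodReductionAtPrime p) (hord : ¬ (p : ℤ) ∣ A.frobeniusTrace p)
    (hirr : A.HasIrreducibleModPGaloisRep p) (hap : ¬ (p : ℤ) ∣ A.frobeniusTrace p - 1)
    {q : ℚ} (hq0 : q ≠ 0) (hL : A.entireLFunction 1 / (A.realPeriodRat : ℂ) = (q : ℂ))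
    (hq : padicValRat p q = 0)
    {N : ℕ} [NeZero N] (f : CuspForm (Gamma0 N) 2) (hf : IsNewformOf A f) :
    ‖PowerSeries.coeff 0 (padicLFunction f (unitRoot A p : ℚ_[p]))‖ = 1 := by
  have hordp : IsOrdinaryAt A p := ⟨hgood, hord⟩
  have hpP : p.Prime := Fact.out
  -- the period unit `Ω_A = u · Ω⁺_f`, `‖u‖_p = 1`
  obtain ⟨u, hu1, huΩ⟩ := h5 A p hp hgood hirr f hf
  have hΩ : A.realPeriodRat ≠ 0 := A.realPeriodRat_pos_holds.ne'
  have hplus : plusPeriod f ≠ 0 :=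
    (IsNewform0.plusPeriod_pos_holds hf.1 hf.coeffField_eq_bot).ne'
  -- `[0]⁺_f = q · u`
  set s : ℚ := ratPlusSymbol f 0 with hs_def
  have hsq : s = q * u := by
    have hL' : A.entireLFunction 1 = (q : ℂ) * (A.realPeriodRat : ℂ) :=
      (div_eq_iff (Complex.ofReal_ne_zero.mpr hΩ)).mp hL
    have h1 : ((s : ℚ) : ℂ) * (plusPeriod f : ℂ) = ((q * u : ℚ) : ℂ) * (plusPeriod f : ℂ) := by
      calc ((s : ℚ) : ℂ) * (plusPeriod f : ℂ) = A.entireLFunction 1 := by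
            rw [hf.entireLFunction_one_eq]; push_cast; ring
        _ = (q : ℂ) * (A.realPeriodRat : ℂ) := hL'
        _ = ((q * u : ℚ) : ℂ) * (plusPeriod f : ℂ) := by rw [huΩ]; push_cast; ring
    have h2 := mul_right_cancel₀ (Complex.ofReal_ne_zero.mpr hplus) h1
    exact_mod_cast h2
  have hqn : ‖(q : ℚ_[p])‖ = 1 := by
    rw [Padic.eq_padicNorm, padicNorm.eq_zpow_of_nonzero hq0, hq, neg_zero, zpow_zero, Rat.cast_one]
  have hsn : ‖(s : ℚ_[p])‖ = 1 := by
    rw [hsq, Rat.cast_mul, norm_mul, hqn, hu1, one_mul]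
  -- `1 − α⁻¹` is a unit (non-anomalous)
  have hna : ¬ p ∣ A.reductionPointCount p :=
    not_dvd_reductionPointCount_of_not_dvd_frobeniusTrace_sub_one A p hap
  obtain ⟨u', hu'⟩ := exists_unit_one_sub_unitRoot_inv p A hordp
  have hcnt : ‖(A.reductionPointCount p : ℚ_[p])‖ = 1 :=
    Padic.norm_natCast_eq_one_iff.mpr ((Nat.Prime.coprime_iff_not_dvd hpP).mpr hna)
  have hun : ‖((u' : ℤ_[p]) : ℚ_[p])‖ = 1 := by
    rw [PadicInt.padic_norm_e_of_padicInt]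
    exact PadicInt.isUnit_iff.mp u'.isUnit
  have h1 : ‖(1 - ((unitRoot A p : ℤ_[p]) : ℚ_[p])⁻¹)‖ = 1 := by
    rw [hu', norm_mul, hun, hcnt, one_mul]
  rw [PowerSeries.coeff_zero_eq_constantCoeff, constantCoeff_padicLFunction_unitRoot hordp hf,
    norm_mul, norm_pow, h1, one_pow, one_mul, ← hs_def, hsn]

/-! ### §2 The crux AT A PAIR from a unit `L`-value (self) and from a unit-`L`-value partner -/

/-- **The degenerate partner.** An X9 pair `(W, p)` (`Rank1Residual.ClassX9`: non-CM, `p ≥ 5` good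
ordinary, `W[p]` irreducible, `ρ̄` not surjective) that is non-anomalous (`p ∤ a_p − 1`) with
`L(W,1)/Ω_W = q`, `q ≠ 0`, `ord_p q = 0` satisfies the conclusion of `AnalyticMuZeroOnClassX9` AT THE
PAIR: every newform `f` of `W` has a unit coefficient of `L_p(f, α_W)` (the constant one) — modulo the
period unit `h5` only. (In rank `0`, by BSD, `q = #Ш_an·∏c_ℓ/#E(ℚ)_tors²`; the hypothesis reads
`p ∤ #Ш_an·∏c_ℓ`, since `p ∤ #E(ℚ)_tors` for irreducible `E[p]`.)
[cite: MazurTateTeitelbaum1986Invent, §I.14 (14.3)] [cite: GreenbergVatsal2000, §3 Remark (3.4)] -/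
theorem analyticMuZeroOnClassX9_at_of_unitLValue (h5 : realPeriodRat_eq_unit_mul_plusPeriod)
    (W : WeierstrassCurve ℚ) [W.IsElliptic] [W.IsGloballyMinimal] (p : ℕ) [Fact p.Prime]
    (hX9 : ClassX9 W p) (hap : ¬ (p : ℤ) ∣ W.frobeniusTrace p - 1)
    {q : ℚ} (hq0 : q ≠ 0) (hL : W.entireLFunction 1 / (W.realPeriodRat : ℂ) = (q : ℂ))
    (hq : padicValRat p q = 0)
    {N : ℕ} [NeZero N] (f : CuspForm (Gamma0 N) 2) (hf : IsNewformOf W f) :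
    ∃ n : ℕ, ‖PowerSeries.coeff n (padicLFunction f (unitRoot W p : ℚ_[p]))‖ = 1 := by
  obtain ⟨-, hp, hgood, hord, hirr, -⟩ := hX9
  exact ⟨0, analyticCertificate_of_unitLValue h5 W p hp hgood hord hirr hap hq0 hL hq f hf⟩

/-- **The crux at an X9 pair from a unit-`L`-value `p`-CONGRUENT partner** (Greenberg–Vatsal /
Emerton–Pollack–Weston transport). Let `(W, p)` be an X9 pair and `A/ℚ` a globally minimal curve with
good ordinary reduction at `p`, a `Γ_ℚ`-equivariant isomorphism `A[p] ≃ W[p]`, `p ∤ a_p(A) − 1` and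
`L(A,1)/Ω_A = q` (`q ≠ 0`, `ord_p q = 0`). Then every newform `f` of `W` has a unit coefficient of
`L_p(f, α_W)`. Inputs (cite-only facts of the K6 cone, as binders): EPW 2006 Thm. 1 `∗ = an` (`hEPW`),
the period unit (`h5`), Carayol (`hlev`), modularity (`hmodP`, a newform of `A`). Proof: `A[p]` is
irreducible (transported from `W[p]`), §1 gives the certificate of `A` at its newform, and
`certificate_of_torsionIso` (koly g6) moves it to `(W, f)`.
[cite: EmertonPollackWeston2006, Thm. 1 (arXiv:math/0404484 p. 2)] [cite: GreenbergVatsal2000, §3 Remark (3.4), Thm. (1.4)]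
[cite: MazurTateTeitelbaum1986Invent, §I.14 (14.3)] -/
theorem analyticMuZeroOnClassX9_at_of_unitLValuePartner
    (hEPW : EmertonPollackWeston2006.thm1_muAn_transfer_of_torsionIso)
    (h5 : realPeriodRat_eq_unit_mul_plusPeriod)
    (hlev : ∀ (N : ℕ) [NeZero N], IsNewformOf.level_eq_conductorNorm (N := N))
    (hmodP : nonempty_modularParametrizationData)
    (W : WeierstrassCurve ℚ) [W.IsElliptic] [W.IsGloballyMinimal] (p : ℕ) [Fact p.Prime]
    (hX9 : ClassX9 W p)
    (A : WeierstrassCurve ℚ) [A.IsElliptic] [A.IsGloballyMinimal]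
    (hgoodA : A.HasGoodReductionAtPrime p) (hordA : ¬ (p : ℤ) ∣ A.frobeniusTrace p)
    (hiso : ∃ e : geomTorsion A (p : ℤ) ≃+ geomTorsion W (p : ℤ),
      ∀ (σ : Field.absoluteGaloisGroup ℚ) (P : geomTorsion A (p : ℤ)), e (σ • P) = σ • e P)
    (hapA : ¬ (p : ℤ) ∣ A.frobeniusTrace p - 1)
    {q : ℚ} (hq0 : q ≠ 0) (hL : A.entireLFunction 1 / (A.realPeriodRat : ℂ) = (q : ℂ))
    (hq : padicValRat p q = 0)
    {N : ℕ} [NeZero N] (f : CuspForm (Gamma0 N) 2) (hf : IsNewformOf W f) :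
    ∃ n : ℕ, ‖PowerSeries.coeff n (padicLFunction f (unitRoot W p : ℚ_[p]))‖ = 1 := by
  obtain ⟨-, hp, hgood, hord, hirr, -⟩ := hX9
  obtain ⟨e, he⟩ := hiso
  have hirrA : A.HasIrreducibleModPGaloisRep p := hasIrreducibleModPGaloisRep_of_torsionIso_symm e he hirr
  -- a newform of the partner (modularity), at which its unit-`L`-value certificate is read
  haveI : NeZero (A.conductorNorm ℤ) := ⟨(A.conductorNorm_pos_holds).ne'⟩
  obtain ⟨Dm⟩ := hmodP A
  have hcertA : ∃ n : ℕ, ‖PowerSeries.coeff n (padicLFunction Dm.f (unitRoot A p : ℚ_[p]))‖ = 1 :=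
    ⟨0, analyticCertificate_of_unitLValue h5 A p hp hgoodA hordA hirrA hapA hq0 hL hq Dm.f
      Dm.isNewformOf⟩
  exact certificate_of_torsionIso hEPW h5 hlev A W p hp hgoodA hordA hirrA hgood hord ⟨e, he⟩ Dm.f
    Dm.isNewformOf f hf hcertA

/-! ### §3 The crux BY NAME from unit-`L`-value partners for every X9 pair (class-level display) -/

/-- **Crux `AnalyticMuZeroX9` BY NAME on the congruence-transfer road.** Granting the three cite-only
facts EPW 2006 Thm. 1 (`hEPW`), the period unit (`h5`), Carayol (`hlev`), and modularity (`hmodP`): IF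
every X9 pair `(W, p)` admits a globally minimal `p`-congruent partner `A/ℚ` — good ordinary at `p`,
`Γ_ℚ`-equivariant `A[p] ≃ W[p]`, non-anomalous, with `L(A,1)/Ω_A` a non-zero rational of `p`-adic
valuation `0` (`A = W` allowed) — THEN `Theses.SmallImageMuTransfer.AnalyticMuZeroX9` holds. The
displayed hypothesis `hpartner` is the exact OPEN content of this road (an ∀∃ over the infinitely many
X9 residual representations); it is not a published fact and is not claimed. Class-wide the crux is
Greenberg's Conj. 1.11 (analytic side) on X9. [cite: EmertonPollackWeston2006, Thm. 1 (arXiv:math/0404484 p. 2)]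
[cite: GreenbergVatsal2000, §3 Remark (3.4), Thm. (1.4)] [cite: GreenbergLNM1716, §1 Conj. 1.11] -/
theorem analyticMuZeroX9_of_forall_exists_unitLValuePartner
    (hEPW : EmertonPollackWeston2006.thm1_muAn_transfer_of_torsionIso)
    (h5 : realPeriodRat_eq_unit_mul_plusPeriod)
    (hlev : ∀ (N : ℕ) [NeZero N], IsNewformOf.level_eq_conductorNorm (N := N))
    (hmodP : nonempty_modularParametrizationData)
    (hpartner : ∀ (W : WeierstrassCurve ℚ) [W.IsElliptic] [W.IsGloballyMinimal] (p : ℕ) [Fact p.Prime],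
      ClassX9 W p →
      ∃ (A : WeierstrassCurve ℚ) (_ : A.IsElliptic) (_ : A.IsGloballyMinimal),
        A.HasGoodReductionAtPrime p ∧ ¬ (p : ℤ) ∣ A.frobeniusTrace p ∧
        (∃ e : geomTorsion A (p : ℤ) ≃+ geomTorsion W (p : ℤ),
          ∀ (σ : Field.absoluteGaloisGroup ℚ) (P : geomTorsion A (p : ℤ)), e (σ • P) = σ • e P) ∧
        ¬ (p : ℤ) ∣ A.frobeniusTrace p - 1 ∧
        ∃ q : ℚ, q ≠ 0 ∧ A.entireLFunction 1 / (A.realPeriodRat : ℂ) = (q : ℂ) ∧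
          padicValRat p q = 0) :
    Summit.BirchSwinnertonDyer.BirchSwinnertonDyer.Theses.SmallImageMuTransfer.AnalyticMuZeroX9 := by
  unfold Summit.BirchSwinnertonDyer.BirchSwinnertonDyer.Theses.SmallImageMuTransfer.AnalyticMuZeroX9
    AnalyticMuZeroOnClassX9
  intro W _ _ p _ N _ f hX9 hf
  obtain ⟨A, _, _, hgoodA, hordA, hiso, hapA, q, hq0, hL, hq⟩ := hpartner W p hX9
  exact analyticMuZeroOnClassX9_at_of_unitLValuePartner hEPW h5 hlev hmodP W p hX9 A hgoodA hordA
    hiso hapA hq0 hL hq f hf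

/-- **The same display with the facts packaged as the route's items**: `MuSplitInputs` (item 19236:
EPW Thm. 1 ∧ period unit ∧ Carayol) and `ModularParametrizationSupply` (item 19266: modularity), plus
the displayed partner hypothesis, give the crux `AnalyticMuZeroX9` by name — an ALTERNATIVE to the
registered split D1 (`MuZeroCMCurves ∧ AnalyticMuZeroX9NoCMPartner ∧ MuSplitInputs`) on the
congruence road, sharing its cite-only inputs item. Not a route edit; a kernel display only.
[cite: EmertonPollackWeston2006, Thm. 1 (arXiv:math/0404484 p. 2)] [cite: GreenbergLNM1716, §1 Conj. 1.11] -/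
theorem analyticMuZeroX9_of_muSplitInputs_of_forall_exists_unitLValuePartner
    (hIn : Summit.BirchSwinnertonDyer.BirchSwinnertonDyer.Theses.SmallImageMuTransfer.MuSplitInputs)
    (hmod : Summit.BirchSwinnertonDyer.BirchSwinnertonDyer.Theses.SmallImageMuTransfer.ModularParametrizationSupply)
    (hpartner : ∀ (W : WeierstrassCurve ℚ) [W.IsElliptic] [W.IsGloballyMinimal] (p : ℕ) [Fact p.Prime],
      ClassX9 W p →
      ∃ (A : WeierstrassCurve ℚ) (_ : A.IsElliptic) (_ : A.IsGloballyMinimal),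
        A.HasGoodReductionAtPrime p ∧ ¬ (p : ℤ) ∣ A.frobeniusTrace p ∧
        (∃ e : geomTorsion A (p : ℤ) ≃+ geomTorsion W (p : ℤ),
          ∀ (σ : Field.absoluteGaloisGroup ℚ) (P : geomTorsion A (p : ℤ)), e (σ • P) = σ • e P) ∧
        ¬ (p : ℤ) ∣ A.frobeniusTrace p - 1 ∧
        ∃ q : ℚ, q ≠ 0 ∧ A.entireLFunction 1 / (A.realPeriodRat : ℂ) = (q : ℂ) ∧
          padicValRat p q = 0) :
    Summit.BirchSwinnertonDyer.BirchSwinnertonDyer.Theses.SmallImageMuTransfer.AnalyticMuZeroX9 := by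
  obtain ⟨hEPW, h5, hlev⟩ := hIn
  exact analyticMuZeroX9_of_forall_exists_unitLValuePartner hEPW h5 hlev hmod hpartner

end Summit.BirchSwinnertonDyer.BirchSwinnertonDyer.Rank1Residual

end
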